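import Mathlib.RingTheory.DedekindDomain.AdicValuation
import Mathlib.NumberTheory.NumberField.Completion.FinitePlace
import Mathlib.RingTheory.Henselian
import Mathlib.RingTheory.AdicCompletion.Noetherian
import Mathlib.Topology.Algebra.Valued.WithZeroMulInt
import Mathlib.Algebra.Polynomial.Reverse
import Mathlib.Algebra.Polynomial.Taylor
import HarnessLib

/-!
# `O_v` is adically complete and Henselian; Hensel's lemma for non-monic polynomials

Let `A` be a Dedekind domain with fraction field `K`, `v` a finite place (height-one prime) and
`O_v = v.adicCompletionIntegers K ⊆ K_v = v.adicCompletion K` the ring of integers of the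
completion (a complete discrete valuation ring; Mathlib: `IsDiscreteValuationRing`,
`CompleteSpace K_v`). This file supplies the algebraic completeness statement Mathlib lacks at
the pin (see the module docstring of `Literature.NumberTheory.EllipticCurves.Tamagawa`:
"Mathlib currently has no `IsAdicComplete` instance for `v.adicCompletionIntegers K`"):

* `IsDedekindDomain.HeightOneSpectrum.adicCompletionIntegers.isAdicComplete`:
  `IsAdicComplete (maximalIdeal O_v) O_v` — a sequence which is Cauchy for the `𝔪`-adic
  filtration is Cauchy in `K_v`, converges, and the limit has the right residues because the
  balls `f n + 𝔪ⁿ` are closed (Serre, *Local Fields*, Ch. II §1; Neukirch, *Algebraic Number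
  Theory*, II.4);
* hence (Mathlib's `IsAdicComplete.henselianRing`) `O_v` is a Henselian local ring,
  `IsDedekindDomain.HeightOneSpectrum.adicCompletionIntegers.henselianLocalRing`
  (Hensel's lemma; Neukirch, *Algebraic Number Theory*, II.4.6; Serre, *Local Fields*, II §4);
* `HenselianLocalRing.exists_isRoot_of_isUnit_derivative`: Hensel's lemma for an *arbitrary*
  (not necessarily monic) polynomial over a Henselian local ring: if `f(a₀) ∈ 𝔪` and `f'(a₀)` is
  a unit then `f` has a root `a ≡ a₀ (mod 𝔪)`. Mathlib's `HenselianLocalRing.is_henselian` is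
  stated for monic `f` only; the general case is reduced to the monic one by the substitution
  `a = a₀ + f(a₀)/T`, which turns `f(a₀ + h) = 0` into a monic equation for `T` whose reduction
  is `T^{N-1}(T + f'(a₀)) = 0` with the simple root `T = -f'(a₀) ≠ 0`
  (Cassels, *Local Fields*, Ch. 4, Lemma 3.1, states Hensel's lemma for an arbitrary
  `f ∈ 𝔬[X]` with `|f(a₀)| < |f'(a₀)|²` over a complete field; the unit case `|f'(a₀)| = 1` is
  the one needed here, and over a Henselian local ring it follows from the monic case by the
  substitution above).

These are used by the elementary computation of `E(K_v)/E₀(K_v)` for split multiplicative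
reduction (`Literature.NumberTheory.EllipticCurves.NeronModelProofs` and its sequels), where the
points of the pieces of `E(K_v) ∖ E₀(K_v)` and the normal form `y² + xy = x³ + a₆` are produced
by Hensel's lemma applied to non-monic equations.

## References

* J. W. S. Cassels, *Local Fields*, LMS Student Texts 3, Cambridge University Press 1986,
  Ch. 4 §3, Lemma 3.1 ("Hensel's Lemma", PDF p. 37, book p. 49).
* J.-P. Serre, *Local Fields*, GTM 67, Springer 1979, Ch. II §1 (complete discrete valuation
  rings as `lim O/𝔪ⁿ`) and §4.
* J. Neukirch, *Algebraic Number Theory*, Grundlehren 322, Springer 1999, Ch. II §4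
  (Hensel's lemma II.4.6).
-/

noncomputable section

open Polynomial IsLocalRing

/-! ### Hensel's lemma for non-monic polynomials over a Henselian local ring -/

namespace HenselianLocalRing

variable {R : Type*} [CommRing R] [HenselianLocalRing R]

/-- **Hensel's lemma, general (non-monic) form.** Over a Henselian local ring `R`, a polynomial
`f` (monic or not) with `f(a₀) ∈ 𝔪` and `f'(a₀) ∈ Rˣ` has a root `a` with `a - a₀ ∈ 𝔪`.
Reduction to Mathlib's monic case (`HenselianLocalRing.is_henselian`, in the residue-field form
of `HenselianLocalRing.TFAE`): write `f(a₀ + Y) = c₀ + Y·Q(Y)` (`Q = (taylor a₀ f).divX`,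
`c₀ = f(a₀)`, `Q(0) = f'(a₀)`), substitute `Y = c₀y` to get `f(a₀ + c₀y) = c₀·H(y)` with
`H(y) = y·Q(c₀y) + 1 ≡ f'(a₀)y + 1 (mod 𝔪)`; the reversed polynomial `H* = Y^N H(1/Y)`
(`N = deg H`) is monic with reduction `Y^{N-1}(Y + f'(a₀))`, whose root `-f'(a₀) ≠ 0` is simple,
so `H*` has a unit root `T` and `a = a₀ + c₀/T` is a root of `f`. This is the case
`|f'(a₀)| = 1` of Cassels, *Local Fields*, Ch. 4, Lemma 3.1 (there for complete fields and any
`f ∈ 𝔬[X]` with `|f(a₀)| < |f'(a₀)|²`); also Neukirch, *Algebraic Number Theory*, II.4.6.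
(Deliberate extension of the Mathlib namespace `HenselianLocalRing`.)
[cite: Cassels1986, Ch. 4 Lemma 3.1] -/
theorem exists_isRoot_of_isUnit_derivative (f : R[X]) (a₀ : R)
    (h₁ : f.eval a₀ ∈ maximalIdeal R) (h₂ : IsUnit (f.derivative.eval a₀)) :
    ∃ a : R, f.IsRoot a ∧ a - a₀ ∈ maximalIdeal R := by
  -- notation: `c₀ = f(a₀)`, `c₁ = f'(a₀)`, `F(Y) = f(a₀ + Y)`
  set c₀ : R := f.eval a₀ with hc₀
  set c₁ : R := f.derivative.eval a₀ with hc₁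
  set F : R[X] := taylor a₀ f with hF
  have hF0 : F.coeff 0 = c₀ := taylor_coeff_zero ..
  have hF1 : F.coeff 1 = c₁ := taylor_coeff_one ..
  have hc₁0 : c₁ ≠ 0 := h₂.ne_zero
  -- `H(y) = y · Q(c₀ y) + 1`, `Q = F.divX`, so that `F(c₀ y) = c₀ H(y)`
  set H : R[X] := X * (F.divX.comp (C c₀ * X)) + 1 with hH
  have hHeval : ∀ y : R, H.eval y = y * F.divX.eval (c₀ * y) + 1 := by
    intro y
    simp only [hH, eval_add, eval_mul, eval_X, eval_comp, eval_C, eval_one]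
  have hFeval : ∀ y : R, F.eval (c₀ * y) = c₀ * H.eval y := by
    intro y
    have h := congrArg (eval (c₀ * y)) (divX_mul_X_add F)
    rw [eval_add, eval_mul, eval_X, eval_C, hF0] at h
    rw [hHeval, ← h]
    ring
  -- coefficients `0` and `1` of `H`
  have hH0 : H.coeff 0 = 1 := by
    rw [hH, coeff_add, coeff_X_mul_zero, coeff_one_zero, zero_add]
  have hdivX0 : F.divX.eval 0 = c₁ := by
    rw [← coeff_zero_eq_eval_zero, coeff_divX, zero_add, hF1]
  have hH1 : H.coeff 1 = c₁ := by
    rw [hH, coeff_add, coeff_X_mul, coeff_one, if_neg one_ne_zero, add_zero,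
      coeff_zero_eq_eval_zero, eval_comp, eval_mul, eval_C, eval_X, mul_zero, hdivX0]
  -- `N = deg H ≥ 1`
  set N : ℕ := H.natDegree with hN
  have hN1 : 1 ≤ N := le_natDegree_of_ne_zero (by rw [hH1]; exact hc₁0)
  obtain ⟨M, hM⟩ : ∃ M, N = M + 1 := ⟨N - 1, by omega⟩
  -- the reversed polynomial `G = H*` is monic
  set G : R[X] := H.reverse with hG
  have hGmonic : G.Monic := by
    rw [Monic, hG, reverse_leadingCoeff,
      trailingCoeff_eq_coeff_zero (by rw [hH0]; exact one_ne_zero), hH0]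
  -- reductions mod `𝔪`: `H ≡ c₁ Y + 1`, `G ≡ Y^M (Y + c₁)`
  have hres0 : residue R c₀ = 0 := (residue_eq_zero_iff _).mpr h₁
  set c : ResidueField R := residue R c₁ with hc
  have hcne : c ≠ 0 := by
    rw [hc, Ne, residue_eq_zero_iff]
    exact fun h => (mem_nonunits_iff.mp ((mem_maximalIdeal _).mp h)) h₂
  have hHmap : H.map (residue R) = C c * X ^ 1 + C 1 * X ^ 0 := by
    rw [hH, Polynomial.map_add, Polynomial.map_mul, Polynomial.map_X, Polynomial.map_one,
      map_comp, Polynomial.map_mul, map_C, Polynomial.map_X, hres0, C_0, zero_mul, comp_zero,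
      eval_zero_map, hdivX0, ← hc, pow_one, pow_zero, C_1, mul_one, mul_comm]
  have hGmap : G.map (residue R) = X ^ M * (X + C c) := by
    rw [hG, reverse, ← hN, ← reflect_map, hHmap, reflect_add, reflect_C_mul_X_pow,
      reflect_C_mul_X_pow, revAt_le hN1, revAt_le (Nat.zero_le N), hM, Nat.add_sub_cancel,
      Nat.sub_zero, C_1, one_mul]
    ring
  -- Hensel (monic, residue-field form) for `G` at `-c`
  have hens := ((HenselianLocalRing.TFAE R).out 0 1).mp ‹HenselianLocalRing R›
  have heval : aeval (-c) G = 0 := by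
    rw [aeval_def, ← eval_map, ResidueField.algebraMap_eq, hGmap]
    simp only [eval_mul, eval_pow, eval_X, eval_add, eval_C, neg_add_cancel, mul_zero]
  have hderiv : aeval (-c) (derivative G) ≠ 0 := by
    rw [aeval_def, ← eval_map, ResidueField.algebraMap_eq, ← derivative_map, hGmap,
      derivative_mul]
    simp only [eval_add, eval_mul, eval_pow, eval_X, eval_C, derivative_add, derivative_X,
      derivative_C, add_zero, neg_add_cancel, mul_zero, zero_add, mul_one]
    exact pow_ne_zero _ (neg_ne_zero.mpr hcne)
  obtain ⟨T, hT, hTres⟩ := hens G hGmonic (-c) heval hderiv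
  -- `T` is a unit
  have hTunit : IsUnit T := by
    by_contra hT'
    have : residue R T = 0 := (residue_eq_zero_iff T).mpr ((mem_maximalIdeal T).mpr
      (mem_nonunits_iff.mpr hT'))
    rw [hTres, neg_eq_zero] at this
    exact hcne this
  set Tu : Rˣ := hTunit.unit with hTu
  have hTuval : (Tu : R) = T := hTunit.unit_spec
  -- `H(1/T) = 0`
  letI : Invertible ((Tu⁻¹ : Rˣ) : R) := ⟨T, by rw [← hTuval, Units.mul_inv], by
    rw [← hTuval, Units.inv_mul]⟩
  have hinvOf : ⅟((Tu⁻¹ : Rˣ) : R) = T := rfl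
  have hHroot : H.eval ((Tu⁻¹ : Rˣ) : R) = 0 := by
    have key := (eval₂_reflect_eq_zero_iff (RingHom.id R) ((Tu⁻¹ : Rˣ) : R) N H le_rfl).mp
    rw [hinvOf, eval₂_id, eval₂_id] at key
    exact key hT
  -- the root of `f`
  refine ⟨a₀ + c₀ * ((Tu⁻¹ : Rˣ) : R), ?_, ?_⟩
  · rw [IsRoot.def, add_comm, ← taylor_eval, ← hF, hFeval, hHroot, mul_zero]
  · rw [add_sub_cancel_left]
    exact Ideal.mul_mem_right _ _ h₁

end HenselianLocalRing

/-! ### `O_v` is `𝔪`-adically complete, hence Henselian -/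

namespace IsDedekindDomain.HeightOneSpectrum

variable {A : Type*} [CommRing A] [IsDedekindDomain A] (K : Type*) [Field K] [Algebra A K]
  [IsFractionRing A K] (v : HeightOneSpectrum A)

/-- Membership in a power of the maximal ideal of `O_v` is read off from the valuation of `K_v`:
`x ∈ 𝔪ⁿ ↔ v(x) ≤ v(ϖ)ⁿ = v(ϖⁿ)` for a uniformiser `ϖ` (`𝔪ⁿ = (ϖⁿ)` in the discrete valuation
ring `O_v`, and divisibility in the valuation ring `O_v` is comparison of valuations,
`Valuation.Integers.le_iff_dvd`). Serre, *Local Fields*, Ch. II §1. [folklore] -/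
theorem adicCompletionIntegers.mem_maximalIdeal_pow_iff {ϖ : v.adicCompletionIntegers K}
    (hϖ : Irreducible ϖ) (n : ℕ) (x : v.adicCompletionIntegers K) :
    x ∈ IsLocalRing.maximalIdeal (v.adicCompletionIntegers K) ^ n ↔
      Valued.v (x : v.adicCompletion K) ≤ Valued.v ((ϖ : v.adicCompletion K) ^ n) := by
  have hv : Valued.v.Integers (v.adicCompletionIntegers K) :=
    Valuation.valuationSubring.integers _
  rw [hϖ.maximalIdeal_eq, Ideal.span_singleton_pow, Ideal.mem_span_singleton, ← hv.le_iff_dvd]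
  rfl

/-- **`O_v` is `𝔪`-adically complete**: `IsAdicComplete (maximalIdeal O_v) O_v` for the ring of
integers `O_v = v.adicCompletionIntegers K` of the completion `K_v` of the fraction field of a
Dedekind domain at a finite place (Serre, *Local Fields*, Ch. II §1: `O_v = lim O_v/𝔪ⁿ`;
Neukirch, *Algebraic Number Theory*, II.4). Mathlib has `CompleteSpace K_v`, the closedness of
`O_v` and of the balls of `K_v`, and `IsHausdorff` for Noetherian local rings; the missing
`IsPrecomplete` half is: a sequence in `O_v` which is Cauchy for the filtration `(𝔪ⁿ)` is Cauchy
in `K_v` (`v(ϖ)ⁿ → 0`), converges in `K_v` to a limit which lies in the closed set `O_v`, and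
lies in each closed ball `f n + 𝔪ⁿ`. Registered as an instance on Mathlib's
`adicCompletionIntegers` (no Mathlib instance exists at the pin). [folklore] -/
instance adicCompletionIntegers.isAdicComplete :
    IsAdicComplete (IsLocalRing.maximalIdeal (v.adicCompletionIntegers K))
      (v.adicCompletionIntegers K) where
  prec' := by
    intro f hf
    obtain ⟨ϖ, hϖ⟩ := IsDiscreteValuationRing.exists_irreducible (v.adicCompletionIntegers K)
    have hv : Valued.v.Integers (v.adicCompletionIntegers K) :=
      Valuation.valuationSubring.integers _
    have hmem : ∀ (n : ℕ) (x : v.adicCompletionIntegers K),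
        x ∈ IsLocalRing.maximalIdeal (v.adicCompletionIntegers K) ^ n •
            (⊤ : Ideal (v.adicCompletionIntegers K)) ↔
          Valued.v (x : v.adicCompletion K) ≤ Valued.v ((ϖ : v.adicCompletion K) ^ n) := by
      intro n x
      rw [smul_eq_mul, Ideal.mul_top, adicCompletionIntegers.mem_maximalIdeal_pow_iff K v hϖ]
    simp only [SModEq.sub_mem, hmem, AddSubgroupClass.coe_sub] at hf ⊢
    have hϖ1 : Valued.v (ϖ : v.adicCompletion K) < 1 := hv.valuation_irreducible_lt_one hϖ
    -- the underlying sequence in `K_v` is Cauchy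
    set g : ℕ → v.adicCompletion K := fun n => (f n : v.adicCompletion K) with hg
    have hpow : Filter.Tendsto (fun n : ℕ => (ϖ : v.adicCompletion K) ^ n) Filter.atTop
        (nhds 0) := Valued.tendsto_zero_pow_of_v_lt_one hϖ1
    have hbound : ∀ {N k : ℕ}, N ≤ k →
        Valued.v.restrict (g k - g N) ≤ Valued.v.restrict ((ϖ : v.adicCompletion K) ^ N) := by
      intro N k hk
      rw [Valuation.restrict_le_iff, Valuation.map_sub_swap]
      exact hf hk
    have hcauchy : CauchySeq g := by
      rw [(Valued.hasBasis_uniformity (v.adicCompletion K) _).cauchySeq_iff]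
      intro γ _
      have hev := (Valued.hasBasis_nhds_zero (v.adicCompletion K) _).tendsto_right_iff.mp hpow γ
        trivial
      obtain ⟨N, hN⟩ := Filter.eventually_atTop.mp hev
      refine ⟨N, fun m hm n hn => ?_⟩
      show Valued.v.restrict (g n - g m) < γ.1
      calc Valued.v.restrict (g n - g m)
          = Valued.v.restrict ((g n - g N) - (g m - g N)) := by rw [sub_sub_sub_cancel_right]
        _ ≤ max (Valued.v.restrict (g n - g N)) (Valued.v.restrict (g m - g N)) :=
            Valuation.map_sub _ _ _
        _ ≤ Valued.v.restrict ((ϖ : v.adicCompletion K) ^ N) := max_le (hbound hn) (hbound hm)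
        _ < γ.1 := hN N le_rfl
    obtain ⟨L, hL⟩ := cauchySeq_tendsto_of_complete hcauchy
    -- the limit lies in the closed subring `O_v`
    have hLmem : L ∈ v.adicCompletionIntegers K :=
      (Valued.isClosed_valuationSubring (v.adicCompletion K)).mem_of_tendsto hL
        (Filter.Eventually.of_forall fun n => (f n).2)
    refine ⟨⟨L, hLmem⟩, fun n => ?_⟩
    -- and in each closed ball `f n + 𝔪ⁿ`
    have hclosed : IsClosed {y : v.adicCompletion K |
        Valued.v (y - g n) ≤ Valued.v ((ϖ : v.adicCompletion K) ^ n)} := by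
      have h1 : IsClosed {y : v.adicCompletion K |
          Valued.v.restrict y ≤ Valued.v.restrict ((ϖ : v.adicCompletion K) ^ n)} :=
        Valued.isClosed_closedBall _ _
      simp only [Valuation.restrict_le_iff] at h1
      exact h1.preimage (continuous_sub_right (g n))
    have hLball : L ∈ {y : v.adicCompletion K |
        Valued.v (y - g n) ≤ Valued.v ((ϖ : v.adicCompletion K) ^ n)} :=
      hclosed.mem_of_tendsto hL (Filter.eventually_atTop.mpr ⟨n, fun k hk => by
        show Valued.v (g k - g n) ≤ _
        rw [Valuation.map_sub_swap]
        exact hf hk⟩)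
    rw [Valuation.map_sub_swap]
    exact hLball

/-- **`O_v` is Henselian** (Hensel's lemma for the complete discrete valuation ring
`O_v = v.adicCompletionIntegers K`; Cassels, *Local Fields*, Ch. 4, Lemma 3.1; Neukirch,
*Algebraic Number Theory*, II.4.6): from `IsAdicComplete` by Mathlib's
`IsAdicComplete.henselianRing`, converted from `HenselianRing O_v 𝔪` to the local form
`HenselianLocalRing O_v` (the derivative conditions "unit mod `𝔪`" and "unit" agree in a local
ring). Registered as an instance (none in Mathlib at the pin).
[cite: Cassels1986, Ch. 4 Lemma 3.1] -/
instance adicCompletionIntegers.henselianLocalRing :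
    HenselianLocalRing (v.adicCompletionIntegers K) where
  is_henselian f hf a₀ h₁ h₂ :=
    HenselianRing.is_henselian (I := IsLocalRing.maximalIdeal (v.adicCompletionIntegers K))
      f hf a₀ h₁ (h₂.map _)

end IsDedekindDomain.HeightOneSpectrum

end
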